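import Summits.PneNP.PneNP.Theses.Feige
import Literature.Computability.Complexity.BrickAlgebra
import Literature.Computability.Complexity.PNPWave0Proofs
import Literature.Computability.Complexity.ClayProblem

/-!
# Route Feige — `NoShortRefutationsImpliesThesis` (stmt-PneNP-1119)

"Deterministic refutation is at least as hard as nondeterministic refutation" (Feige–Kim–Ofek 2006, §1): a deterministic
polynomial-time sound refuter `f` accepting `F₃(n, ⌈Δn⌉)` with probability `≥ 1/2` eventually yields the verifier
`V := f ∘ fstF` (`V ⟨x, π⟩ = f x`), polynomial-time (`fstF ∈ FP`, composition), sound, and with witness bound `p := 0`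
accepting a superset of `{φ | f (encode φ) = true}`; so `NoShortRefutations → FeigeThesis`.
-/

set_option linter.dupNamespace false -- `Summit.PneNP.PneNP.…`: summit = sub-problem name (D-0017 single-conjunct layout)

namespace Summit.PneNP.PneNP.Theorems

open Filter MeasureTheory
open Literature.Computability.Complexity

/-- **Support item `NoShortRefutationsImpliesThesis` of route Feige (stmt-PneNP-1119)**: `NoShortRefutations → FeigeThesis`
— a deterministic refuter violating `FeigeHypothesis Δ` is a zero-witness nondeterministic refutation scheme
(`V = f ∘ fstF`, witness bound `0`). [cite: FeigeKimOfek2006, §1] -/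
theorem feige_noShortRefutationsImpliesThesis_proof :
    Summit.PneNP.PneNP.Theses.Feige.NoShortRefutationsImpliesThesis := by
  unfold Summit.PneNP.PneNP.Theses.Feige.NoShortRefutationsImpliesThesis
    Summit.PneNP.PneNP.Theses.Feige.NoShortRefutations Summit.PneNP.PneNP.Theses.Feige.FeigeThesis
  intro hNo Δ hΔ
  unfold Literature.Computability.Complexity.FeigeHypothesis
  rintro ⟨f, hf, hsound, hev⟩
  have hfst : IsPolyTime Brick.fstF := (isPolyTime_iff Brick.fstF).2 Brick.fstF_mem_FP
  refine hNo Δ hΔ ⟨f ∘ Brick.fstF, hfst.comp_isPolyTimePred hf, ?_, 0, ?_⟩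
  · intro φ π hV
    simp only [Function.comp, Brick.fstF_boolPair] at hV
    exact hsound φ hV
  · refine hev.mono fun n hn => hn.trans (measure_mono ?_)
    intro φ hφ
    exact ⟨[], by simp, by simpa [Function.comp, Brick.fstF_boolPair] using hφ⟩

end Summit.PneNP.PneNP.Theorems
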